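import Mathlib

/-!
# The asymptotic input of Theorem C (night-1, gen 0): a real sequence tending to `2^q/2^d < 1` is eventually `< 1`

`F q d K₂ K₃ n := (2^q/2^d) · ((n/(n−d))^q + K₂/(n−d)) + K₃ · n^{q+d}/2^n` tends to `2^q/2^d` as `n → ∞`
(`n/(n−d) → 1`, `1/(n−d) → 0`, `n^k/2^n → 0`), so for `d ≥ q + 1` it is eventually `< 1`: `exists_bound_F`.
Imports Mathlib only. Axioms: standard.
-/

namespace PercRepro

open Filter Topology

/-- The real sequence whose eventual smallness drives Theorem C. -/
noncomputable def seqF (q d : ℕ) (K₂ K₃ : ℝ) (n : ℕ) : ℝ :=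
  (2 : ℝ) ^ q / 2 ^ d * (((n : ℝ) / ((n : ℝ) - d)) ^ q + K₂ / ((n : ℝ) - d)) +
    K₃ * ((n : ℝ) ^ (q + d) / 2 ^ n)

/-- `n / (n − d) → 1`. -/
theorem tendsto_div_sub (d : ℕ) :
    Tendsto (fun n : ℕ => (n : ℝ) / ((n : ℝ) - d)) atTop (𝓝 1) := by
  have h := tendsto_natCast_div_add_atTop (𝕜 := ℝ) (-(d : ℝ))
  refine h.congr (fun n => ?_)
  simp [sub_eq_add_neg]

/-- `1 / (n − d) → 0`. -/
theorem tendsto_inv_sub (d : ℕ) :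
    Tendsto (fun n : ℕ => 1 / ((n : ℝ) - d)) atTop (𝓝 0) := by
  have h1 : Tendsto (fun n : ℕ => (n : ℝ) - d) atTop atTop := by
    have := tendsto_natCast_atTop_atTop (R := ℝ)
    exact tendsto_atTop_add_const_right atTop (-(d : ℝ)) this |>.congr (fun n => by ring)
  have h2 := tendsto_inv_atTop_zero.comp h1
  refine h2.congr (fun n => ?_)
  simp [Function.comp, one_div]

/-- `seqF q d K₂ K₃ n → 2^q / 2^d`. -/
theorem tendsto_seqF (q d : ℕ) (K₂ K₃ : ℝ) :
    Tendsto (seqF q d K₂ K₃) atTop (𝓝 ((2 : ℝ) ^ q / 2 ^ d)) := by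
  have h1 : Tendsto (fun n : ℕ => ((n : ℝ) / ((n : ℝ) - d)) ^ q) atTop (𝓝 1) := by
    simpa using (tendsto_div_sub d).pow q
  have h2 : Tendsto (fun n : ℕ => K₂ / ((n : ℝ) - d)) atTop (𝓝 0) := by
    have := (tendsto_inv_sub d).const_mul K₂
    simp only [mul_zero] at this
    refine this.congr (fun n => ?_)
    ring
  have h3 : Tendsto (fun n : ℕ => K₃ * ((n : ℝ) ^ (q + d) / 2 ^ n)) atTop (𝓝 0) := by
    have := (tendsto_pow_const_div_const_pow_of_one_lt (q + d) (by norm_num : (1 : ℝ) < 2)).const_mul K₃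
    simpa using this
  have h12 : Tendsto (fun n : ℕ => (2 : ℝ) ^ q / 2 ^ d *
      (((n : ℝ) / ((n : ℝ) - d)) ^ q + K₂ / ((n : ℝ) - d))) atTop (𝓝 ((2 : ℝ) ^ q / 2 ^ d * (1 + 0))) :=
    (h1.add h2).const_mul _
  have := h12.add h3
  simp only [add_zero, mul_one] at this
  exact this

/-- **Eventually `seqF < 1`** when `q + 1 ≤ d`: there is `N₀` with `seqF q d K₂ K₃ n < 1` for all `n ≥ N₀`. -/
theorem exists_bound_seqF (q d : ℕ) (hqd : q + 1 ≤ d) (K₂ K₃ : ℝ) :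
    ∃ N₀ : ℕ, ∀ n, N₀ ≤ n → seqF q d K₂ K₃ n < 1 := by
  have hlim := tendsto_seqF q d K₂ K₃
  have hlt : (2 : ℝ) ^ q / 2 ^ d < 1 := by
    rw [div_lt_one (by positivity)]
    exact pow_lt_pow_right₀ (by norm_num) (by omega)
  have hev : ∀ᶠ n in atTop, seqF q d K₂ K₃ n < 1 := hlim.eventually (gt_mem_nhds hlt)
  obtain ⟨N₀, hN₀⟩ := eventually_atTop.1 hev
  exact ⟨N₀, hN₀⟩

end PercRepro
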